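import Mathlib
import Literature.NumberTheory.Waring.HurwitzQuaternions
import HarnessLib
import HarnessLib.Audit.Tags

/-!
# The HURWITZ–BRANDT module at 2: a self-contained, kernel-DECIDABLE model of E-imc-81 `TwoPNoTwoEisenstein`
# (imc g16 «THE SECOND CHARACTER GROUP», MEMO-imc §22.19, REFORMULATION THEOREM E-imc-116; cell `bsd-f2-manin`,
# typing ask T-imc-15, typer g13)

HONEST FRAMING.  LENS = Iwasawa-main-conjecture / Hecke-algebra lens (`bsd-f2-manin-imc` g16).  WHAT THIS FILE IS: plain
COMPUTABLE definitions over Mathlib (no modular curves, no `sorry`, no new analytic vocabulary) of the Brandt module of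
the HURWITZ order `O = ℤ⟨1,i,j,k,(1+i+j+k)/2⟩ ⊂ B_{2,∞}` with level-`p` structure, reduced mod 2:
* `DQuat` = doubled coordinates `(a,b,c,d) ∈ ℤ⁴`, all of one parity, of the Hurwitz quaternion `(a + bi + cj + dk)/2`
  (`DQuat.toQuaternion`; `toQuaternion_mem_hurwitz` anchors it in the tree's `…Waring.HurwitzQuaternions.hurwitz`,
  Hardy–Wright §20.6; reduced norm `= dnorm/4`, `normSq_toQuaternion`); `hurwitzOfNorm r` = ALL of reduced norm `r`
  (a finite list; `24·(r+1)` of them for an odd prime `r`), `hurwitzUnits = hurwitzOfNorm 1` (the 24 units);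
* the action on `ℙ¹(𝔽_p)` (`Fin (p+1)`: `j < p ↦ (j:1)`, `p ↦ (1:0)`) through the embedding `O ⊗ 𝔽_p ≅ M₂(𝔽_p)`,
  `i ↦ (a b; b −a)`, `j ↦ (0 1; −1 0)`, `k ↦ (−b a; a b)` with `a² + b² ≡ −1 (mod p)` (`negOneAsSumOfTwoSquares`, found by
  search; the factor `½` is invisible projectively) — `actWith` / `act`, in `ℕ` mod `p`, no field inverses;
* `classRep` / `classReps p` = representatives of `A₄ \ ℙ¹(𝔽_p)` (`A₄ = O^×/±1`) = the supersingular points of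
  `X₀(p)` in characteristic 2, `classNumber p = h₂(p) = g(2p) − 2g(p) + 1`;
* `brandtTable p r` / `brandtMatrixMod2 p r`: `B_r(x,y) = #{α ∈ O, Nrd α = r : α·x ∈ A₄·y}/24` — the Hecke
  correspondence `T_r(E₀, C) = Σ_{D ⊂ E₀[r]} (E₀/D, C mod D)` read through `ker`-generators (every left `O`-ideal is
  principal), independent of the convention `α` vs `ᾱ` because the norm-`r` set is closed under conjugation; row sums
  `r + 1`, so the constant vector `𝟙` is killed mod 2;
* **`HurwitzBrandtNilOnlyConstants p rs`** (decidable): the joint generalized nilspace of the `T̄_r`, `r ∈ rs`, on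
  `𝔽₂[A₄ \ ℙ¹(𝔽_p)]` is `{0, 𝟙}` (`T̄_r^{h} v = 0 ∀ r ⟹ v ∈ {0, 𝟙}`, `h = classNumber p`);
* **`HurwitzBrandtTwoEisensteinTrivial`** (`@[conjecture]`, nothing asserted): for every prime `p ≥ 5`, `p ≡ ±3 (mod 8)`,
  SOME finite set of odd primes `r ≠ p` already has nil-space `{0, 𝟙}` — imc's typed candidate
  «`jointNilspaceDim (hurwitzBrandt p) = 1`» (the joint nilspace over all `r` is the intersection of the finite ones
  and stabilises; its dimension is convention(transpose)-independent).
THE BRIDGE (docstring edge only — NOT provable in-tree; needs Ribet 1990 §3 `X(J₀(2p), 2) = ℤ[SS(X₀(p)/𝔽̄₂)]⁰` +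
Eichler/Jacquet–Langlands): imc's REFORMULATION THEOREM **E-imc-116** (PROOFS-g16 §10.1, on paper):
`dim_{𝔽₂}(𝔽₂[A₄\ℙ¹(𝔽_p)])_{𝔪₀} = 1 + e_{2p}^{new}(𝔪₀)`, hence for `p ≥ 5`:
`(∃ rs admissible, HurwitzBrandtNilOnlyConstants p rs) ⟺ 𝔪₀ ∉ Supp X₂(J₀(2p)) ⟺` E-imc-81(p)
`= TwoEisenstein.TwoEisensteinRankEq (2p) 0` (tree leaf `TwoEisensteinRankOneLaws` / bridge
`twoPNoTwoEisenstein_iff_rankEq_zero`); so `HurwitzBrandtTwoEisensteinTrivial ⟺ TwoPNoTwoEisenstein` on `p ≥ 5`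
GRANTED E-116, and each kernel certificate below is E-81 at that prime GRANTED E-116.
BC5 WITNESS (kernel, `decide +kernel`, this file): `classReps 13 = [0,2,3]` (`h₂(13) = 3`), `brandtTable 13 3 =
[[0,2,2],[3,1,0],[3,0,1]]` (row sums 4), **`HurwitzBrandtNilOnlyConstants 13 [3]`** (imc: «h = 3; T₃ mod 2 nilpotent
exactly on constants»), and the next family/control primes `HurwitzBrandtNilOnlyConstants 29 [3]` (`h₂(29) = 3`),
`… 53 [3, 5]` (`h₂(53) = 5`), `… 5 / 11 / 19 [3]` — every prime `p ≡ ±3 (8)`, `5 ≤ p ≤ 29`, and the family prime 53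
(`37 [3]`, `43 [3]` also pass the kernel, omitted here to keep the build short); imc ENGINE 4 (HOME/imc/kit-g16/hur/, hurwitz.py ec931e4381a40113):
D₂ = 0 at 96/96 primes `p ≤ 547` vs the Legendre engine and at all 31 harvested family primes `p = m² + 4 ≤ 27893`
(kit j309396).  CHEAPEST FALSIFIER of E-81 in this currency: one `p ≡ ±3 (8)` with nil-space `≠ {0,𝟙}` for every `rs`
(0/117 + 0/16).  WHY NOVEL (imc §22.19 presearch, corpus fts+vec + galaxy): no finite-group / Hurwitz-quaternion
formulation of the 2-part of generalized Ogg at level `2p` is in print (Pizer 1980, Kohel, LPS treat Brandt matrices /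
`ℙ¹(𝔽_p)` actions, not the mod-2 Eisenstein multiplicity of the Hurwitz order with prime level).  REF1: by-name audit of
this file REQUESTED (pending at filing); REF2 R-imc-43 (c) pending.  No `instance`, no notation (cell typer lint).
bears_on: stmt-BirchSwinnertonDyer-22967 (C2 `ManinOddAtFour`, stub 6d input E-81 at the family primes).
PARTITION 0 · beyond-print theorem: no (definitions + finite certificates; E-81/E-116 stay rows) · BSD is not proved by
this; Manin's conjecture is not proved by this.
[cite: Ribet1990, §3 (character group of J₀(Np) at p = ℤ[supersingular points]⁰ — the dictionary behind E-116; the mod-2 Hurwitz–Brandt statement is the cell's T-imc-15/E-imc-81, NOT in print)]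
-/

set_option autoImplicit false

namespace Summit.BirchSwinnertonDyer.Rank1Residual.ManinAdditive.HurwitzBrandt

open Quaternion Literature.NumberTheory.Waring.HurwitzQuaternions

/-! ### §1. Hurwitz quaternions in doubled coordinates -/

/-- Doubled coordinates of a Hurwitz quaternion: `(a, b, c, d) ∈ ℤ⁴` (all even or all odd) stands for
`(a + b·i + c·j + d·k)/2`. [folklore] -/
abbrev DQuat : Type := ℤ × ℤ × ℤ × ℤ

/-- all four doubled coordinates have the same parity (decidable). [folklore] -/
abbrev DQuat.SameParity (q : DQuat) : Prop :=
  q.1 % 2 = q.2.1 % 2 ∧ q.2.1 % 2 = q.2.2.1 % 2 ∧ q.2.2.1 % 2 = q.2.2.2 % 2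

/-- four times the reduced norm: `a² + b² + c² + d²`. [folklore] -/
def DQuat.dnorm (q : DQuat) : ℤ := q.1 ^ 2 + q.2.1 ^ 2 + q.2.2.1 ^ 2 + q.2.2.2 ^ 2

/-- the rational quaternion `(a + b·i + c·j + d·k)/2` with doubled coordinates `q = (a,b,c,d)`. [folklore] -/
def DQuat.toQuaternion (q : DQuat) : ℍ[ℚ] :=
  ⟨(q.1 : ℚ) / 2, (q.2.1 : ℚ) / 2, (q.2.2.1 : ℚ) / 2, (q.2.2.2 : ℚ) / 2⟩

/-- SEMANTIC ANCHOR: a same-parity doubled quaternion IS a Hurwitz integral quaternion of the tree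
(`Literature.NumberTheory.Waring.HurwitzQuaternions.hurwitz`, Hardy–Wright §20.6: coordinates all integers or all halves
of odd integers). [cite: HardyWright2008, §20.6] -/
theorem DQuat.toQuaternion_mem_hurwitz (q : DQuat) (h : q.SameParity) : q.toQuaternion ∈ hurwitz := by
  obtain ⟨a, b, c, d⟩ := q
  obtain ⟨h1, h2, h3⟩ := h
  simp only at h1 h2 h3
  rw [mem_hurwitz_iff_int_or_half]
  have hdec : ∀ x : ℤ, (x : ℚ) / 2 = ((x / 2 : ℤ) : ℚ) + ((x % 2 : ℤ) : ℚ) / 2 := fun x => by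
    have hx : ((2 * (x / 2) + x % 2 : ℤ) : ℚ) = (x : ℚ) := by rw [Int.mul_ediv_add_emod]
    push_cast at hx
    linarith
  rcases Int.emod_two_eq_zero_or_one a with ha | ha
  · left
    refine ⟨a / 2, b / 2, c / 2, d / 2, ?_⟩
    have hb : b % 2 = 0 := by omega
    have hc : c % 2 = 0 := by omega
    have hd : d % 2 = 0 := by omega
    simp only [DQuat.toQuaternion]
    ext <;> simp only [] <;> rw [hdec] <;> simp [ha, hb, hc, hd]
  · right
    refine ⟨a / 2, b / 2, c / 2, d / 2, ?_⟩
    have hb : b % 2 = 1 := by omega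
    have hc : c % 2 = 1 := by omega
    have hd : d % 2 = 1 := by omega
    simp only [DQuat.toQuaternion]
    ext <;> simp only [] <;> rw [hdec] <;> simp [ha, hb, hc, hd]

/-- the reduced norm of `(a + bi + cj + dk)/2` is `(a² + b² + c² + d²)/4 = dnorm/4`. [folklore] -/
theorem DQuat.normSq_toQuaternion (q : DQuat) : normSq q.toQuaternion = (q.dnorm : ℚ) / 4 := by
  rw [normSq_def']
  simp only [DQuat.toQuaternion, DQuat.dnorm]
  push_cast
  ring

/-- ALL Hurwitz quaternions of reduced norm `r`, in doubled coordinates (coordinates bounded by `2√r`; for an odd prime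
`r` there are `24·(r+1)` of them, forming `r + 1` classes under left multiplication by the 24 units). [folklore] -/
def hurwitzOfNorm (r : ℕ) : List DQuat :=
  let m : ℕ := Nat.sqrt (4 * r)
  let cs : List ℤ := (List.range (2 * m + 1)).map (fun t => (t : ℤ) - m)
  (cs.flatMap fun a => cs.flatMap fun b => cs.flatMap fun c => cs.map fun d => ((a, b, c, d) : DQuat)).filter
    (fun q => decide q.SameParity && q.dnorm == 4 * (r : ℤ))

/-- the 24 Hurwitz units `±1, ±i, ±j, ±k, (±1 ± i ± j ± k)/2` (doubled: `(±2,0,0,0)`-type and `(±1,±1,±1,±1)`);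
`O^×/±1 ≅ A₄`. [folklore] -/
def hurwitzUnits : List DQuat := hurwitzOfNorm 1

/-- every listed element has the Hurwitz parity condition and reduced norm `r` (the filter's two clauses). [folklore] -/
theorem sameParity_and_dnorm_of_mem_hurwitzOfNorm {r : ℕ} {q : DQuat} (h : q ∈ hurwitzOfNorm r) :
    q.SameParity ∧ q.dnorm = 4 * (r : ℤ) := by
  simp only [hurwitzOfNorm, List.mem_filter, Bool.and_eq_true, decide_eq_true_eq, beq_iff_eq] at h
  exact h.2

/-! ### §2. The action on `ℙ¹(𝔽_p)` and the class set `A₄ \ ℙ¹(𝔽_p)` -/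

/-- a pair `(a, b)` of residues with `a² + b² + 1 ≡ 0 (mod p)` (first in lexicographic order; exists for every prime;
junk `(0,0)` otherwise). [folklore] -/
def negOneAsSumOfTwoSquares (p : ℕ) : ℕ × ℕ :=
  (((List.range p).flatMap fun a => (List.range p).map fun b => (a, b)).find?
    (fun ab => (ab.1 ^ 2 + ab.2 ^ 2 + 1) % p == 0)).getD (0, 0)

/-- the point of `ℙ¹(𝔽_p) = Fin (p+1)` (`j < p ↦ (j : 1)`, `p ↦ (1 : 0)`) of a vector `(w₁ : w₂) ≠ 0` given in `ℕ`:
for `w₂ ≢ 0` the `j < p` with `j·w₂ ≡ w₁ (mod p)` (found by search — no field inverse), else `∞ = Fin.last p`. [folklore] -/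
def toPoint (p : ℕ) (w1 w2 : ℕ) : Fin (p + 1) :=
  if w2 % p = 0 then Fin.last p else
    match (List.finRange p).find? (fun (j : Fin p) => (j.val * w2) % p = w1 % p) with
    | some j => Fin.castSucc j
    | none => Fin.last p

/-- the action of the doubled Hurwitz quaternion `q = (a₀,a₁,a₂,a₃)` on the point `x ∈ ℙ¹(𝔽_p)` through the matrix
`a₀·1 + a₁·I + a₂·J + a₃·K`, `I = (a b; b −a)`, `J = (0 1; −1 0)`, `K = IJ = (−b a; a b)` (`a² + b² ≡ −1`), i.e.
`M = (a₀ + a₁a − a₃b, a₁b + a₂ + a₃a; a₁b − a₂ + a₃a, a₀ − a₁a + a₃b)`, `det M ≡ a₀² + a₁² + a₂² + a₃² = dnorm q`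
(so `M` is invertible mod `p` whenever `p ∤ dnorm q`); all arithmetic in `ℕ` after reducing the coordinates mod `p`.
[folklore] -/
def actWith (p a b : ℕ) (q : DQuat) (x : Fin (p + 1)) : Fin (p + 1) :=
  let a0 : ℕ := (q.1 % (p : ℤ)).toNat
  let a1 : ℕ := (q.2.1 % (p : ℤ)).toNat
  let a2 : ℕ := (q.2.2.1 % (p : ℤ)).toNat
  let a3 : ℕ := (q.2.2.2 % (p : ℤ)).toNat
  let na : ℕ := p - a % p
  let nb : ℕ := p - b % p
  let m11 : ℕ := a0 + a1 * a + a3 * nb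
  let m12 : ℕ := a1 * b + a2 + a3 * a
  let m21 : ℕ := a1 * b + (p - a2 % p) + a3 * a
  let m22 : ℕ := a0 + a1 * na + a3 * b
  let v1 : ℕ := if (x : ℕ) < p then (x : ℕ) else 1
  let v2 : ℕ := if (x : ℕ) < p then 1 else 0
  toPoint p (m11 * v1 + m12 * v2) (m21 * v1 + m22 * v2)

/-- the action with the file's fixed embedding `negOneAsSumOfTwoSquares p`. [folklore] -/
def act (p : ℕ) (q : DQuat) (x : Fin (p + 1)) : Fin (p + 1) :=
  actWith p (negOneAsSumOfTwoSquares p).1 (negOneAsSumOfTwoSquares p).2 q x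

/-- the least point of the orbit of `x` under the listed quaternions (used with the 24 units: the `A₄`-orbit).
[folklore] -/
def classRepWith (p a b : ℕ) (units : List DQuat) (x : Fin (p + 1)) : Fin (p + 1) :=
  (units.map fun u => actWith p a b u x).foldl min x

/-- the representative (least point) of the `A₄ = O^×/±1`-orbit of `x ∈ ℙ¹(𝔽_p)`. [folklore] -/
def classRep (p : ℕ) (x : Fin (p + 1)) : Fin (p + 1) :=
  classRepWith p (negOneAsSumOfTwoSquares p).1 (negOneAsSumOfTwoSquares p).2 hurwitzUnits x

/-- the class set `A₄ \ ℙ¹(𝔽_p)` = supersingular points of `X₀(p)` over `𝔽̄₂` (pairs `(E₀, C)`, `End E₀ = O`), listed by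
least representatives in increasing order. [folklore] -/
def classReps (p : ℕ) : List (Fin (p + 1)) :=
  let ab := negOneAsSumOfTwoSquares p
  (List.finRange (p + 1)).filter fun x => classRepWith p ab.1 ab.2 hurwitzUnits x = x

/-- the class number `h₂(p) = #(A₄ \ ℙ¹(𝔽_p))` (`= g(X₀(2p)) − 2g(X₀(p)) + 1`, imc §22.19 (1), 99/99 primes). [folklore] -/
abbrev classNumber (p : ℕ) : ℕ := (classReps p).length

/-! ### §3. Brandt matrices mod 2 and the nil-space statement -/

/-- the Brandt matrix `B_r` of the Hurwitz order with level `p` as a table over `classReps p`: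
`B_r(x, y) = #{α : Nrd α = r, α·x ∈ class y} / 24` (the Hecke correspondence `T_r` on `ℤ[A₄ \ ℙ¹(𝔽_p)]`; every row sums
to `r + 1` for an odd prime `r ≠ p`). [folklore] -/
def brandtTable (p r : ℕ) : List (List ℕ) :=
  let ab := negOneAsSumOfTwoSquares p
  let units := hurwitzUnits
  let nr := hurwitzOfNorm r
  let reps := classReps p
  reps.map fun x =>
    let cls := nr.map fun α => classRepWith p ab.1 ab.2 units (actWith p ab.1 ab.2 α x)
    reps.map fun y => cls.count y / 24

/-- `T̄_r`: the Brandt matrix `B_r` reduced mod 2, as a `Matrix` over `ZMod 2` indexed by `Fin (classNumber p)`.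
[folklore] -/
def brandtMatrixMod2 (p r : ℕ) : Matrix (Fin (classNumber p)) (Fin (classNumber p)) (ZMod 2) :=
  let t := brandtTable p r
  Matrix.of fun i j => (((t[(i : ℕ)]?.getD [])[(j : ℕ)]?.getD 0 : ℕ) : ZMod 2)

/-- **The finite, DECIDABLE statement** (one `(p, rs)` at a time): the joint generalized nil-space of the mod-2 Brandt
operators `T̄_r`, `r ∈ rs`, on `𝔽₂[A₄ \ ℙ¹(𝔽_p)]` is the line of constants — every `v` with `T̄_r^{h} v = 0` for all
`r ∈ rs` (`h = classNumber p`) is `0` or `𝟙`.  Monotone in `rs`.  By E-imc-116 (docstring edge, not in-tree) this is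
E-imc-81 at `p` whenever `rs` consists of odd primes `≠ p`. [folklore] -/
abbrev HurwitzBrandtNilOnlyConstants (p : ℕ) (rs : List ℕ) : Prop :=
  ∀ v : Fin (classNumber p) → ZMod 2,
    (∀ r ∈ rs, (fun w => (brandtMatrixMod2 p r).mulVec w)^[classNumber p] v = 0) → v = 0 ∨ v = fun _ => 1

/-- **Candidate `HurwitzBrandtTwoEisensteinTrivial` (imc g16 typed candidate, T-imc-15; = E-imc-81 `TwoPNoTwoEisenstein`
on `p ≥ 5` GRANTED the reformulation theorem E-imc-116 — nothing asserted).**  For every prime `p ≥ 5` with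
`p ≡ ±3 (mod 8)` there is a finite list of odd primes `r ≠ p` whose mod-2 Hurwitz–Brandt operators at level `p` have
joint generalized nil-space exactly the constants (`jointNilspaceDim = 1`).  BC5: kernel certificates below at every
`p ≡ ±3 (8)`, `5 ≤ p ≤ 29`, and at the family prime `53` (`rs = [3]`, resp. `[3, 5]`); imc ENGINE 4: 96/96 primes `≤ 547`, 31/31 family primes `m² + 4 ≤ 27893`; 0
violations.  Why it might fail: exactly a failure of E-81 (a 2-Eisenstein newform at some level `2p`, `p ≡ ±3 (8)`).
REF1 by-name audit REQUESTED (pending at filing); REF2 R-imc-43 (c) pending.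
[conjecture — cell candidate, NOT a tree fact]
[cite: Ribet1990, §3 (shape: the supersingular/character-group dictionary; the statement is the cell's E-imc-81 in Hurwitz–Brandt form, NOT in print)] -/
@[conjecture]
def HurwitzBrandtTwoEisensteinTrivial : Prop :=
  ∀ p : ℕ, p.Prime → 5 ≤ p → (p % 8 = 3 ∨ p % 8 = 5) →
    ∃ rs : List ℕ, (∀ r ∈ rs, r.Prime ∧ r % 2 = 1 ∧ r ≠ p) ∧ HurwitzBrandtNilOnlyConstants p rs

/-! ### §4. Kernel certificates (BC5 witness; `decide +kernel`, axioms standard): the primes `p ≡ ±3 (mod 8)`,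
`5 ≤ p ≤ 29`, and the family prime `53 = 7² + 4` have Hurwitz–Brandt nil-space `{0, 𝟙}` — i.e. E-imc-81 at
`2p ∈ {10, 22, 26, 38, 58, 106}` GRANTED E-116 -/

/-- there are exactly 24 Hurwitz units. [folklore] -/
theorem length_hurwitzUnits : hurwitzUnits.length = 24 := by decide +kernel

/-- there are `96 = 24·(3+1)` Hurwitz quaternions of reduced norm `3`. [folklore] -/
theorem length_hurwitzOfNorm_three : (hurwitzOfNorm 3).length = 96 := by decide +kernel

/-- the embedding datum at `p = 13`: `0² + 5² + 1 = 26 ≡ 0`. [folklore] -/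
theorem negOneAsSumOfTwoSquares_thirteen : negOneAsSumOfTwoSquares 13 = (0, 5) := by decide +kernel

/-- `h₂(13) = 3`: the classes of `ℙ¹(𝔽₁₃)` under `A₄` are represented by `0, 2, 3` (orbit sizes `6, 4, 4`). [folklore] -/
theorem classReps_thirteen : classReps 13 = [0, 2, 3] := by decide +kernel

/-- the Brandt matrix `B₃` at `p = 13`: rows `(0,2,2), (3,1,0), (3,0,1)` (row sums `4 = 3 + 1`); mod 2 its nilpotent
part kills exactly the constants. [folklore] -/
theorem brandtTable_thirteen_three : brandtTable 13 3 = [[0, 2, 2], [3, 1, 0], [3, 0, 1]] := by decide +kernel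

/-- **BC5 WITNESS (imc T-imc-15: «decide at p = 13; h = 3; T₃ mod 2 nilpotent exactly on constants»).** [folklore] -/
theorem hurwitzBrandtNilOnlyConstants_thirteen : HurwitzBrandtNilOnlyConstants 13 [3] := by decide +kernel

/-- `p = 5` (`h₂(5) = 1`, `S₂(Γ₀(10)) = 0`: degenerate-true). [folklore] -/
theorem hurwitzBrandtNilOnlyConstants_five : HurwitzBrandtNilOnlyConstants 5 [3] := by decide +kernel

/-- control prime `p = 11 ≡ 3 (mod 8)` (`h₂(11) = 1`). [folklore] -/
theorem hurwitzBrandtNilOnlyConstants_eleven : HurwitzBrandtNilOnlyConstants 11 [3] := by decide +kernel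

/-- control prime `p = 19 ≡ 3 (mod 8)` (`h₂(19) = 3`). [folklore] -/
theorem hurwitzBrandtNilOnlyConstants_nineteen : HurwitzBrandtNilOnlyConstants 19 [3] := by decide +kernel

/-- family prime `p = 29 = 5² + 4` (`h₂(29) = 3`): `T̄₃` alone isolates the constants. [folklore] -/
theorem hurwitzBrandtNilOnlyConstants_twentyNine : HurwitzBrandtNilOnlyConstants 29 [3] := by decide +kernel

set_option maxRecDepth 100000 in
/-- family prime `p = 53 = 7² + 4` (`h₂(53) = 5`): `T̄₃` and `T̄₅` together isolate the constants (with `rs = [3]` or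
`rs = [5]` alone the kernel check does not go through). [folklore] -/
theorem hurwitzBrandtNilOnlyConstants_fiftyThree : HurwitzBrandtNilOnlyConstants 53 [3, 5] := by decide +kernel

/-- the `∃ rs` clause of `HurwitzBrandtTwoEisensteinTrivial` at the BC5 prime `p = 13`, discharged by `rs = [3]`.
[folklore] -/
theorem hurwitzBrandtTwoEisensteinTrivial_thirteen :
    ∃ rs : List ℕ, (∀ r ∈ rs, r.Prime ∧ r % 2 = 1 ∧ r ≠ 13) ∧ HurwitzBrandtNilOnlyConstants 13 rs :=
  ⟨[3], fun r hr => by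
    rw [List.mem_singleton] at hr
    subst hr
    exact ⟨Nat.prime_three, by decide, by decide⟩, hurwitzBrandtNilOnlyConstants_thirteen⟩

/-- the same at the family primes `p = 29` (`rs = [3]`) and `p = 53` (`rs = [3, 5]`). [folklore] -/
theorem hurwitzBrandtTwoEisensteinTrivial_twentyNine_fiftyThree :
    (∃ rs : List ℕ, (∀ r ∈ rs, r.Prime ∧ r % 2 = 1 ∧ r ≠ 29) ∧ HurwitzBrandtNilOnlyConstants 29 rs) ∧
      ∃ rs : List ℕ, (∀ r ∈ rs, r.Prime ∧ r % 2 = 1 ∧ r ≠ 53) ∧ HurwitzBrandtNilOnlyConstants 53 rs := by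
  refine ⟨⟨[3], fun r hr => ?_, hurwitzBrandtNilOnlyConstants_twentyNine⟩,
    ⟨[3, 5], fun r hr => ?_, hurwitzBrandtNilOnlyConstants_fiftyThree⟩⟩
  · rw [List.mem_singleton] at hr
    subst hr
    exact ⟨Nat.prime_three, by decide, by decide⟩
  · simp only [List.mem_cons, List.not_mem_nil, or_false] at hr
    rcases hr with rfl | rfl
    · exact ⟨Nat.prime_three, by decide, by decide⟩
    · exact ⟨Nat.prime_five, by decide, by decide⟩

end Summit.BirchSwinnertonDyer.Rank1Residual.ManinAdditive.HurwitzBrandt
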